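import Summits.Ventures.QEC.Basic.HypergraphProductParams
import Literature.InformationTheory.QuantumCodes.CSSParameters

/-!
# `HGP(H₁, H₂)` as a CSS code and its census parameters `[[n, k, d]]` from CLASSICAL data — PROVED

LADDER-QEC (venture cell `qec`, PARTITION v2.3 item 04.HGPK "HGP KERNEL PIPELINE"), `Summits/Ventures/QEC/Basic/`.
The hypergraph product `HGP(H₁,H₂)` (`HX = [H₁ ⊗ 1 | 1 ⊗ H₂ᵀ]`, `HZ = [1 ⊗ H₂ | H₁ᵀ ⊗ 1]`,
`Basic/HypergraphProduct.lean`) packaged as a `CSSCode` of row type-02's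
`Literature.InformationTheory.QuantumCodes.CSSCode` (`HGP.code`), and the theorems that turn CLASSICAL
certificates about the two seeds — `rank Hᵢ = rᵢ`, `d(ker Hᵢ) = dᵢ`, `d(ker Hᵢᵀ) = dᵢᵀ` (or `⊤`) — into the
census predicate `CSSCode.IsCode (HGP.code H₁ H₂) n k d` (type-02's `[[n, k, d]]`, exact distance through
Tillich–Zémor's `cssMinDist`) WITHOUT any enumeration over the quantum code:

* `HGP.code_k_eq` — `k = (n₁ − r₁)(n₂ − r₂) + (m₁ − r₁)(m₂ − r₂)` (`= k₁k₂ + k₁ᵀk₂ᵀ`, TZ Theorem 7);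
* `HGP.distance_le_min` — if both `ker Hᵢ ≠ 0` then `D ≤ min(d₁, d₂)` (TZ Lemma 10 for `ℋ₁·ℋ₂ᵀ` and for its
  Poincaré dual); `HGP.distance_le_min_transpose` — if both `ker Hᵢᵀ ≠ 0` then `D ≤ min(d₁ᵀ, d₂ᵀ)`;
* with TZ Theorem 9 (`HGP.distance_ge`: `D ≥ min(d₁, d₂, d₁ᵀ, d₂ᵀ)`): `HGP.distance_eq_min_of_le_transpose`
  (`d₁, d₂ < ⊤` and `min(d₁,d₂) ≤ d₁ᵀ, d₂ᵀ` ⇒ `D = min(d₁,d₂)`; contains the full-rank case `dᵢᵀ = ⊤` of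
  `HGP.distance_eq_min`), `HGP.distance_eq_min_transpose_of_le` (the dual case) and `HGP.distance_eq_min_min`
  (all four codes nonzero ⇒ `D = min(d₁, d₂, d₁ᵀ, d₂ᵀ)` EXACTLY);
* the census corollaries `HGP.isCode_of_le_transpose`, `HGP.isCode_of_transpose_le`, `HGP.isCode_of_min_min`:
  hypotheses = the classical certificate outputs + three closed numeral identities (`n`, `k`, `d`), conclusion
  `(HGP.code H₁ H₂).IsCode n k d`.

HONEST FRAMING: theorems about ALL pairs of binary matrices; a census row `HGP_<seed₁>_x_<seed₂>` reaches tier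
KERNEL when a file under `Census/HGP/` instantiates one of the corollaries with kernel-checked (`decide`) classical
certificates of the two seeds (`Census/ClassicalDistCert.lean`, `Census/RankCert.lean`). Rows whose distance is NOT
determined by the four classical distances (TZ's bounds not tight) are outside this lane and need a quantum
certificate (`Census/CertCheck.lean`).

References: [TillichZemor2014] Tillich–Zémor, IEEE Trans. IT 60 (2014) 1193 = arXiv:0903.0566v1, Thm 7 (chunk
p0007 L126-135), Thm 9 (p0008 L11-15), Lemma 10 (p0008 L57-62); [BreuckmannEberhardt2021] Breuckmann–Eberhardt,
PRX Quantum 2 (2021) 040101 = arXiv:2103.06309, §4.1 (chunk p0009 L21: `[[n₁n₂ + r₁r₂, k₁k₂, min{d₁,d₂}]]`);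
[BravyiEtAl2024] Bravyi et al., Nature 627 (2024) 778, §4 Lemma 1 (the `[[n,k,d]]` of a CSS pair).
-/

namespace Summit.Ventures.QEC.HGP

open Matrix Module
open scoped Kronecker
open Literature.InformationTheory.QuantumCodes
open Literature.InformationTheory.Coding (minDist minDist_bot minDist_le_hammingNorm le_minDist_iff)

variable {m₁ n₁ m₂ n₂ : ℕ}

/-! ### The CSS code `HGP(H₁, H₂)` -/

/-- **`HGP(H₁,H₂)` as a CSS code**: check matrices `HGP.HX H₁ H₂`, `HGP.HZ H₁ H₂` on the qubit set
`(Fin n₁ × Fin n₂) ⊕ (Fin m₁ × Fin m₂)`, commutation `HGP.HX_mul_HZ_transpose` (TZ Prop. 3). Column: definition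
(computable). [cite: TillichZemor2014, §3-§4 and Prop. 3 (arXiv v1 chunks p0006 L56-90, p0007 L1-8, L44-48)] -/
def code (H₁ : Matrix (Fin m₁) (Fin n₁) (ZMod 2)) (H₂ : Matrix (Fin m₂) (Fin n₂) (ZMod 2)) :
    CSSCode (Fin m₁ × Fin n₂) (Fin n₁ × Fin m₂) ((Fin n₁ × Fin n₂) ⊕ (Fin m₁ × Fin m₂)) :=
  CSSCode.ofMatrices (HX H₁ H₂) (HZ H₁ H₂) (HX_mul_HZ_transpose H₁ H₂)

/-- The `X`-check matrix of `HGP.code H₁ H₂` is `HGP.HX H₁ H₂` (definitional). [cite: TillichZemor2014, §3 (arXiv v1 chunk p0007 L1-8)] -/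
@[simp] theorem code_HX (H₁ : Matrix (Fin m₁) (Fin n₁) (ZMod 2)) (H₂ : Matrix (Fin m₂) (Fin n₂) (ZMod 2)) :
    (code H₁ H₂).HX = HX H₁ H₂ := rfl

/-- The `Z`-check matrix of `HGP.code H₁ H₂` is `HGP.HZ H₁ H₂` (definitional). [cite: TillichZemor2014, §3 (arXiv v1 chunk p0007 L1-8)] -/
@[simp] theorem code_HZ (H₁ : Matrix (Fin m₁) (Fin n₁) (ZMod 2)) (H₂ : Matrix (Fin m₂) (Fin n₂) (ZMod 2)) :
    (code H₁ H₂).HZ = HZ H₁ H₂ := rfl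

/-- **Number of logical qubits of `HGP(H₁,H₂)` from the seed ranks**: if `rank H₁ = r₁` and `rank H₂ = r₂` then
`k = (n₁ − r₁)(n₂ − r₂) + (m₁ − r₁)(m₂ − r₂)` (`= k₁k₂ + k₁ᵀk₂ᵀ` with `kᵢ = nᵢ − rᵢ = dim ker Hᵢ`,
`kᵢᵀ = mᵢ − rᵢ = dim ker Hᵢᵀ`; TZ Theorem 7 via `HGP.k_eq` and type-02's `CSSCode.k_eq`).
[cite: TillichZemor2014, Thm 7 (arXiv v1 chunk p0007 L126-135)] -/
theorem code_k_eq (H₁ : Matrix (Fin m₁) (Fin n₁) (ZMod 2)) (H₂ : Matrix (Fin m₂) (Fin n₂) (ZMod 2))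
    {r₁ r₂ : ℕ} (hr₁ : H₁.rank = r₁) (hr₂ : H₂.rank = r₂) :
    (code H₁ H₂).k = (n₁ - r₁) * (n₂ - r₂) + (m₁ - r₁) * (m₂ - r₂) := by
  have hk := (code H₁ H₂).k_eq
  have hle := (code H₁ H₂).rank_HX_add_rank_HZ_le
  rw [code_HX, code_HZ, card_qubits] at hk hle
  have A1 := rank_add_finrank_pcCode H₁
  have A1t := rank_add_finrank_pcCode H₁ᵀ
  have A2 := rank_add_finrank_pcCode H₂
  have A2t := rank_add_finrank_pcCode H₂ᵀ
  rw [Matrix.rank_transpose] at A1t A2t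
  simp only [Fintype.card_fin] at A1 A1t A2 A2t
  have hK := k_eq H₁ H₂
  -- substitute the kernel dimensions `kᵢ = nᵢ − rᵢ`, `kᵢᵀ = mᵢ − rᵢ`
  have e1 : finrank (ZMod 2) (pcCode H₁) = n₁ - r₁ := by omega
  have e1t : finrank (ZMod 2) (pcCode H₁ᵀ) = m₁ - r₁ := by omega
  have e2 : finrank (ZMod 2) (pcCode H₂) = n₂ - r₂ := by omega
  have e2t : finrank (ZMod 2) (pcCode H₂ᵀ) = m₂ - r₂ := by omega
  rw [e1, e1t, e2, e2t] at hK
  have hP : ((n₁ - r₁) * (n₂ - r₂) + (m₁ - r₁) * (m₂ - r₂) : ℕ) + (HX H₁ H₂).rank + (HZ H₁ H₂).rank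
      = n₁ * n₂ + m₁ * m₂ := by
    have : (((n₁ - r₁) * (n₂ - r₂) + (m₁ - r₁) * (m₂ - r₂) : ℕ) : ℤ) + (HX H₁ H₂).rank + (HZ H₁ H₂).rank
        = ((n₁ * n₂ + m₁ * m₂ : ℕ) : ℤ) := by
      push_cast
      linear_combination -hK
    exact_mod_cast this
  omega

/-! ### Upper bounds from Tillich–Zémor Lemma 10 -/

/-- **`D ≤ min(d₁, d₂)` when both seed codes are nonzero** (`d₁, d₂ < ⊤`): `D ≤ d₁` is TZ Lemma 10 (first clause)
for `ℋ₁·ℋ₂ᵀ`, `D ≤ d₂` is TZ Lemma 10 (second clause) for the Poincaré dual `ℋ₁ᵀ·ℋ₂` (`cssMinDist_transpose`).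
[cite: TillichZemor2014, Lemma 10 (arXiv v1 chunk p0008 L57-62)] -/
theorem distance_le_min (H₁ : Matrix (Fin m₁) (Fin n₁) (ZMod 2)) (H₂ : Matrix (Fin m₂) (Fin n₂) (ZMod 2))
    (hd₁ : minDist (pcCode H₁) < ⊤) (hd₂ : minDist (pcCode H₂) < ⊤) :
    cssMinDist (HX H₁ H₂) (HZ H₁ H₂) ≤ min (minDist (pcCode H₁)) (minDist (pcCode H₂)) := by
  refine le_min ?_ ?_
  · refine (HypergraphProduct.minDist_le_holds (Fin m₁) (Fin n₁) (Fin n₂) (Fin m₂) H₁ H₂ᵀ).1 hd₁ ?_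
    rwa [Matrix.transpose_transpose]
  · rw [HX, HZ, ← HypergraphProduct.cssMinDist_transpose, Matrix.transpose_transpose]
    refine (HypergraphProduct.minDist_le_holds (Fin n₁) (Fin m₁) (Fin m₂) (Fin n₂) H₁ᵀ H₂).2 hd₂ ?_
    rwa [Matrix.transpose_transpose]

/-- **`D ≤ min(d₁ᵀ, d₂ᵀ)` when both transpose codes are nonzero** (`d₁ᵀ, d₂ᵀ < ⊤`): `D ≤ d₂ᵀ` is TZ Lemma 10
(second clause) for `ℋ₁·ℋ₂ᵀ`, `D ≤ d₁ᵀ` is its first clause for the Poincaré dual `ℋ₁ᵀ·ℋ₂`.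
[cite: TillichZemor2014, Lemma 10 (arXiv v1 chunk p0008 L57-62)] -/
theorem distance_le_min_transpose (H₁ : Matrix (Fin m₁) (Fin n₁) (ZMod 2))
    (H₂ : Matrix (Fin m₂) (Fin n₂) (ZMod 2))
    (hd₁ : minDist (pcCode H₁ᵀ) < ⊤) (hd₂ : minDist (pcCode H₂ᵀ) < ⊤) :
    cssMinDist (HX H₁ H₂) (HZ H₁ H₂) ≤ min (minDist (pcCode H₁ᵀ)) (minDist (pcCode H₂ᵀ)) := by
  refine le_min ?_ ?_
  · rw [HX, HZ, ← HypergraphProduct.cssMinDist_transpose, Matrix.transpose_transpose]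
    exact (HypergraphProduct.minDist_le_holds (Fin n₁) (Fin m₁) (Fin m₂) (Fin n₂) H₁ᵀ H₂).1 hd₁ hd₂
  · exact (HypergraphProduct.minDist_le_holds (Fin m₁) (Fin n₁) (Fin n₂) (Fin m₂) H₁ H₂ᵀ).2 hd₂ hd₁

/-! ### Exact distance in the three determined regimes -/

/-- **`D = min(d₁, d₂)`** when `d₁, d₂ < ⊤` and `min(d₁, d₂) ≤ d₁ᵀ`, `min(d₁, d₂) ≤ d₂ᵀ` (in `ℕ∞`; e.g. both
seeds of full row rank, `dᵢᵀ = ⊤` — Breuckmann–Eberhardt's `[[n₁n₂ + r₁r₂, k₁k₂, min{d₁,d₂}]]` — or square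
circulant seeds with `dᵢᵀ = dᵢ`): `≥` by TZ Theorem 9, `≤` by Lemma 10.
[cite: TillichZemor2014, Thm 9 and Lemma 10 (arXiv v1 chunk p0008 L11-15, L57-62)]
[cite: BreuckmannEberhardt2021, §4.1 (arXiv chunk p0009 L21)] -/
theorem distance_eq_min_of_le_transpose (H₁ : Matrix (Fin m₁) (Fin n₁) (ZMod 2))
    (H₂ : Matrix (Fin m₂) (Fin n₂) (ZMod 2))
    (hd₁ : minDist (pcCode H₁) < ⊤) (hd₂ : minDist (pcCode H₂) < ⊤)
    (ht₁ : min (minDist (pcCode H₁)) (minDist (pcCode H₂)) ≤ minDist (pcCode H₁ᵀ))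
    (ht₂ : min (minDist (pcCode H₁)) (minDist (pcCode H₂)) ≤ minDist (pcCode H₂ᵀ)) :
    cssMinDist (HX H₁ H₂) (HZ H₁ H₂) = min (minDist (pcCode H₁)) (minDist (pcCode H₂)) := by
  refine le_antisymm (distance_le_min H₁ H₂ hd₁ hd₂) (le_trans ?_ (distance_ge H₁ H₂))
  exact le_min le_rfl (le_min ht₁ ht₂)

/-- **`D = min(d₁ᵀ, d₂ᵀ)`** when `d₁ᵀ, d₂ᵀ < ⊤` and `min(d₁ᵀ, d₂ᵀ) ≤ d₁`, `≤ d₂` (the Poincaré-dual regime).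
[cite: TillichZemor2014, Thm 9 and Lemma 10 (arXiv v1 chunk p0008 L11-15, L57-62)] -/
theorem distance_eq_min_transpose_of_le (H₁ : Matrix (Fin m₁) (Fin n₁) (ZMod 2))
    (H₂ : Matrix (Fin m₂) (Fin n₂) (ZMod 2))
    (hd₁ : minDist (pcCode H₁ᵀ) < ⊤) (hd₂ : minDist (pcCode H₂ᵀ) < ⊤)
    (ht₁ : min (minDist (pcCode H₁ᵀ)) (minDist (pcCode H₂ᵀ)) ≤ minDist (pcCode H₁))
    (ht₂ : min (minDist (pcCode H₁ᵀ)) (minDist (pcCode H₂ᵀ)) ≤ minDist (pcCode H₂)) :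
    cssMinDist (HX H₁ H₂) (HZ H₁ H₂) = min (minDist (pcCode H₁ᵀ)) (minDist (pcCode H₂ᵀ)) := by
  refine le_antisymm (distance_le_min_transpose H₁ H₂ hd₁ hd₂) (le_trans ?_ (distance_ge H₁ H₂))
  exact le_min (le_min ht₁ ht₂) le_rfl

/-- **`D = min(d₁, d₂, d₁ᵀ, d₂ᵀ)` EXACTLY when all four classical codes are nonzero** (all four distances
finite): TZ Theorem 9 gives `≥`, Lemma 10 (both clauses, for `ℋ₁·ℋ₂ᵀ` and its dual) gives `≤`.
[cite: TillichZemor2014, Thm 9 and Lemma 10 (arXiv v1 chunk p0008 L11-15, L57-62)] -/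
theorem distance_eq_min_min (H₁ : Matrix (Fin m₁) (Fin n₁) (ZMod 2)) (H₂ : Matrix (Fin m₂) (Fin n₂) (ZMod 2))
    (hd₁ : minDist (pcCode H₁) < ⊤) (hd₂ : minDist (pcCode H₂) < ⊤)
    (hd₁t : minDist (pcCode H₁ᵀ) < ⊤) (hd₂t : minDist (pcCode H₂ᵀ) < ⊤) :
    cssMinDist (HX H₁ H₂) (HZ H₁ H₂) =
      min (min (minDist (pcCode H₁)) (minDist (pcCode H₂)))
        (min (minDist (pcCode H₁ᵀ)) (minDist (pcCode H₂ᵀ))) := by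
  refine le_antisymm ?_ (distance_ge H₁ H₂)
  exact le_min (distance_le_min H₁ H₂ hd₁ hd₂) (distance_le_min_transpose H₁ H₂ hd₁t hd₂t)

/-! ### The census predicate `[[n, k, d]]` from classical certificates -/

/-- Casting `min` of naturals into `ℕ∞`. [folklore] -/
theorem natCast_min_enat (a b : ℕ) : ((min a b : ℕ) : ℕ∞) = min (a : ℕ∞) (b : ℕ∞) := by
  rcases le_total a b with h | h
  · rw [min_eq_left h, min_eq_left (ENat.coe_le_coe.2 h)]
  · rw [min_eq_right h, min_eq_right (ENat.coe_le_coe.2 h)]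

/-- **Census corollary, regime `min(d₁,d₂) ≤ d₁ᵀ, d₂ᵀ`**: classical certificates `rank Hᵢ = rᵢ`, `d(ker Hᵢ) = dᵢ`
(natural numbers, so both seed codes are nonzero) and the two comparisons `min(d₁,d₂) ≤ dᵢᵀ` in `ℕ∞` (automatic
when `Hᵢ` has full row rank: `dᵢᵀ = ⊤`) give `HGP(H₁,H₂) = [[n₁n₂ + m₁m₂, (n₁−r₁)(n₂−r₂) + (m₁−r₁)(m₂−r₂), min(d₁,d₂)]]`
in the sense of type-02's `CSSCode.IsCode` (exact distance). The last three hypotheses are the closed numeral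
identities a census file discharges by `decide`.
[cite: TillichZemor2014, Thm 7, Thm 9, Lemma 10 (arXiv v1 chunks p0007 L126-135, p0008 L11-15, L57-62)]
[cite: BreuckmannEberhardt2021, §4.1 (arXiv chunk p0009 L21)] -/
theorem isCode_of_le_transpose (H₁ : Matrix (Fin m₁) (Fin n₁) (ZMod 2)) (H₂ : Matrix (Fin m₂) (Fin n₂) (ZMod 2))
    {r₁ r₂ d₁ d₂ n k d : ℕ} (hr₁ : H₁.rank = r₁) (hr₂ : H₂.rank = r₂)
    (hd₁ : minDist (pcCode H₁) = d₁) (hd₂ : minDist (pcCode H₂) = d₂)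
    (ht₁ : ((min d₁ d₂ : ℕ) : ℕ∞) ≤ minDist (pcCode H₁ᵀ)) (ht₂ : ((min d₁ d₂ : ℕ) : ℕ∞) ≤ minDist (pcCode H₂ᵀ))
    (hn : n₁ * n₂ + m₁ * m₂ = n) (hk : (n₁ - r₁) * (n₂ - r₂) + (m₁ - r₁) * (m₂ - r₂) = k) (hd : min d₁ d₂ = d) :
    (code H₁ H₂).IsCode n k d := by
  refine ⟨by rw [card_qubits, hn], by rw [code_k_eq H₁ H₂ hr₁ hr₂, hk], ?_⟩
  rw [code_HX, code_HZ, ← hd, natCast_min_enat, ← hd₁, ← hd₂]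
  rw [natCast_min_enat, ← hd₁, ← hd₂] at ht₁ ht₂
  exact distance_eq_min_of_le_transpose H₁ H₂ (hd₁ ▸ ENat.coe_lt_top d₁) (hd₂ ▸ ENat.coe_lt_top d₂) ht₁ ht₂

/-- **Census corollary, dual regime `min(d₁ᵀ,d₂ᵀ) ≤ d₁, d₂`**: certificates `rank Hᵢ = rᵢ`, `d(ker Hᵢᵀ) = dᵢᵀ`
(natural numbers) and the comparisons `min(d₁ᵀ,d₂ᵀ) ≤ dᵢ` in `ℕ∞` give
`HGP(H₁,H₂) = [[n₁n₂ + m₁m₂, (n₁−r₁)(n₂−r₂) + (m₁−r₁)(m₂−r₂), min(d₁ᵀ,d₂ᵀ)]]`.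
[cite: TillichZemor2014, Thm 7, Thm 9, Lemma 10 (arXiv v1 chunks p0007 L126-135, p0008 L11-15, L57-62)] -/
theorem isCode_of_transpose_le (H₁ : Matrix (Fin m₁) (Fin n₁) (ZMod 2)) (H₂ : Matrix (Fin m₂) (Fin n₂) (ZMod 2))
    {r₁ r₂ e₁ e₂ n k d : ℕ} (hr₁ : H₁.rank = r₁) (hr₂ : H₂.rank = r₂)
    (he₁ : minDist (pcCode H₁ᵀ) = e₁) (he₂ : minDist (pcCode H₂ᵀ) = e₂)
    (ht₁ : ((min e₁ e₂ : ℕ) : ℕ∞) ≤ minDist (pcCode H₁)) (ht₂ : ((min e₁ e₂ : ℕ) : ℕ∞) ≤ minDist (pcCode H₂))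
    (hn : n₁ * n₂ + m₁ * m₂ = n) (hk : (n₁ - r₁) * (n₂ - r₂) + (m₁ - r₁) * (m₂ - r₂) = k) (hd : min e₁ e₂ = d) :
    (code H₁ H₂).IsCode n k d := by
  refine ⟨by rw [card_qubits, hn], by rw [code_k_eq H₁ H₂ hr₁ hr₂, hk], ?_⟩
  rw [code_HX, code_HZ, ← hd, natCast_min_enat, ← he₁, ← he₂]
  rw [natCast_min_enat, ← he₁, ← he₂] at ht₁ ht₂
  exact distance_eq_min_transpose_of_le H₁ H₂ (he₁ ▸ ENat.coe_lt_top e₁) (he₂ ▸ ENat.coe_lt_top e₂) ht₁ ht₂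

/-- **Census corollary, all four classical codes nonzero**: certificates `rank Hᵢ = rᵢ`, `d(ker Hᵢ) = dᵢ`,
`d(ker Hᵢᵀ) = eᵢ` (natural numbers) give
`HGP(H₁,H₂) = [[n₁n₂ + m₁m₂, (n₁−r₁)(n₂−r₂) + (m₁−r₁)(m₂−r₂), min(d₁, d₂, e₁, e₂)]]` EXACTLY.
[cite: TillichZemor2014, Thm 7, Thm 9, Lemma 10 (arXiv v1 chunks p0007 L126-135, p0008 L11-15, L57-62)] -/
theorem isCode_of_min_min (H₁ : Matrix (Fin m₁) (Fin n₁) (ZMod 2)) (H₂ : Matrix (Fin m₂) (Fin n₂) (ZMod 2))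
    {r₁ r₂ d₁ d₂ e₁ e₂ n k d : ℕ} (hr₁ : H₁.rank = r₁) (hr₂ : H₂.rank = r₂)
    (hd₁ : minDist (pcCode H₁) = d₁) (hd₂ : minDist (pcCode H₂) = d₂)
    (he₁ : minDist (pcCode H₁ᵀ) = e₁) (he₂ : minDist (pcCode H₂ᵀ) = e₂)
    (hn : n₁ * n₂ + m₁ * m₂ = n) (hk : (n₁ - r₁) * (n₂ - r₂) + (m₁ - r₁) * (m₂ - r₂) = k)
    (hd : min (min d₁ d₂) (min e₁ e₂) = d) :
    (code H₁ H₂).IsCode n k d := by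
  refine ⟨by rw [card_qubits, hn], by rw [code_k_eq H₁ H₂ hr₁ hr₂, hk], ?_⟩
  rw [code_HX, code_HZ, ← hd, natCast_min_enat, natCast_min_enat, natCast_min_enat, ← hd₁, ← hd₂, ← he₁, ← he₂]
  exact distance_eq_min_min H₁ H₂ (hd₁ ▸ ENat.coe_lt_top d₁) (hd₂ ▸ ENat.coe_lt_top d₂)
    (he₁ ▸ ENat.coe_lt_top e₁) (he₂ ▸ ENat.coe_lt_top e₂)

end Summit.Ventures.QEC.HGP
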